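import Literature.Computability.AlgebraicComplexity.BorderRankMatMulThreeKernelSound
import HarnessLib

/-!
# Borel-fixed `(110)`-candidates of `⟨3,3,3⟩`, VII: soundness of the kernel procedure, one group

Topic `Literature/Computability/AlgebraicComplexity`. Second half of the soundness proof of
`BorderRankMatMulThreeKernel.lean` (semantics: `BorderRankMatMulThreeKernelSound.lean`):

* `MatMul3.Ker.colOf`, `colOf_decodeRow`, `minorK`, `minorZ`, `detL_groupMatrix` — the columns
  of a certificate over `K`, their minor, and the kernel's integer matrices/determinants;
* `MatMul3.Ker.det_minorK_ne_zero`, `linearIndependent_of_groupCond` — a group accepted by the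
  checker (`groupCond`) consists of linearly independent columns: its `k × k` minor is the
  determinant `detL` (case A: integer, non-zero in characteristic `0`; case B: `αA + βB` by
  linearity of `det` in the parametric column, non-zero for `α, β, α - β ≠ 0` by the admissible
  shapes `(c,0), (0,c), (c,-c)`).

The assembly over a certificate and the final bound are `…KernelBound.lean`.

## References

* A. Conner, A. Harper, J. M. Landsberg, *New lower bounds for matrix multiplication and `det₃`*,
  Forum Math. Pi 11 (2023) e17, arXiv:1911.07981 — §3, §6. [ConnerHarperLandsberg2023]
-/

noncomputable section

open scoped BigOperators

namespace Literature.Computability.AlgebraicComplexity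

namespace BorderApolarity

namespace MatMul3

namespace Ker

universe u

variable {K : Type u} [Field K]

/-! ## Columns of a certificate over `K` -/

/-- Decoding a row `(x₀,x₁,x₂)` of codes. [folklore] -/
def decodeRow (x : ℕ × ℕ × ℕ) : I9' × I9' × I9' := (decode9 x.1, decode9 x.2.1, decode9 x.2.2)

/-- The column labelled `(s₀, m)` over `K`. [folklore] -/
def colOf (tk : Bool) (α β : K) (vs : List MVec) (sm : ℕ × ℕ) : I9' × I9' × I9' → K :=
  if tk then colK α β (vs.getD sm.2 (.unit 0 0 0)) (decode9 sm.1)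
  else colI α β (vs.getD sm.2 (.unit 0 0 0)) (decode9 sm.1)

/-- **Entries of a column at a decoded row are the kernel's `entry`.** [folklore] -/
theorem colOf_decodeRow (tk : Bool) (α β : K) (vs : List MVec) {sm : ℕ × ℕ} (hs : sm.1 < 9)
    {x : ℕ × ℕ × ℕ} (hx : x.1 < 9 ∧ x.2.1 < 9 ∧ x.2.2 < 9) :
    colOf tk α β vs sm (decodeRow x) = (entry tk (vs.getD sm.2 (.unit 0 0 0)) sm.1 x).eval α β := by
  cases tk
  · simp only [colOf, Bool.false_eq_true, if_false, entry, decodeRow, colI_apply, codeA_decode9 hs,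
      codeA_decode9 hx.1, codeA_decode9 hx.2.1, codeA_decode9 hx.2.2]
  · simp only [colOf, if_true, entry, decodeRow, colK_apply, codeA_decode9 hs,
      codeA_decode9 hx.1, codeA_decode9 hx.2.1, codeA_decode9 hx.2.2]

/-- A column lies in the skew image when the vectors lie in `E`. [folklore] -/
theorem colOf_mem (tk : Bool) (α β : K) {vs : List MVec} {E : Submodule K (I9' × I9' → K)}
    (hE : ∀ v ∈ vs, v.toFun α β ∈ E) (h0 : (MVec.unit 0 0 0).toFun α β ∈ E) (sm : ℕ × ℕ) :
    colOf tk α β vs sm ∈ (if tk then (slicesK E).map (skewKL (K := K)) else (slicesI E).map (skewIL (K := K))) := by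
  have hv : (vs.getD sm.2 (.unit 0 0 0)).toFun α β ∈ E := by
    rw [List.getD_eq_getElem?_getD]
    cases h : vs[sm.2]? with
    | none => simpa using h0
    | some v => simpa using hE v (List.mem_of_getElem? h)
  cases tk
  · simpa [colOf] using colI_mem α β hv (decode9 sm.1)
  · simpa [colOf] using colK_mem α β hv (decode9 sm.1)

/-- The rows' weight: a column is supported on the rows of its weight `colWt`. [folklore] -/
theorem colOf_ne_zero (tk : Bool) (α β : K) {vs : List MVec} (hwf : ∀ v ∈ vs, v.wf) (sm : ℕ × ℕ)
    {y : I9' × I9' × I9'} (h : colOf tk α β vs sm y ≠ 0) :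
    rowWt tk (codeA y.1, codeA y.2.1, codeA y.2.2) = colWt tk (vs.getD sm.2 (.unit 0 0 0)) (codeA (decode9 sm.1)) := by
  have hv : (vs.getD sm.2 (.unit 0 0 0)).wf := by
    rw [List.getD_eq_getElem?_getD]
    cases h : vs[sm.2]? with
    | none => simp [MVec.wf]
    | some v => simpa using hwf v (List.mem_of_getElem? h)
  cases tk
  · exact colI_ne_zero α β hv _ (by simpa [colOf] using h)
  · exact colK_ne_zero α β hv _ (by simpa [colOf] using h)

/-! ## One group: a non-singular minor makes the columns independent -/

section Group

variable (tk : Bool) (α β : K) (vs : List MVec) (g : CGroup)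

/-- The minor of a group over `K`: rows = the certificate's rows, columns = its columns. [folklore] -/
def minorK : Matrix (Fin g.rows.length) (Fin g.cols.length) K :=
  fun t r => colOf tk α β vs (g.cols.getD r (0, 0)) (decodeRow (g.rows.getD t (0, 0, 0)))

/-- The integer part-`p` matrix of a group as a `Matrix` (the kernel's `groupMatrix`). [folklore] -/
def minorZ (p : ℕ) : Matrix (Fin g.rows.length) (Fin g.cols.length) ℤ :=
  fun t r =>
    let sm := g.cols.getD r (0, 0)
    let e := entry tk (vs.getD sm.2 (.unit 0 0 0)) sm.1 (g.rows.getD t (0, 0, 0))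
    if (r : ℕ) + 1 = g.cols.length then (if p = 0 then e.1 else if p = 1 then e.2.1 else e.2.2) else e.1

/-- `groupMatrix` represents `minorZ`. [folklore] -/
theorem groupMatrix_getD (p : ℕ) (t : Fin g.rows.length) (r : Fin g.cols.length) :
    ((groupMatrix tk vs g p).getD t []).getD r 0 = minorZ tk vs g p t r := by
  simp only [groupMatrix, minorZ, List.getD_eq_getElem?_getD, List.getElem?_map,
    List.getElem?_eq_getElem t.isLt, List.getElem?_range r.isLt, Option.map_some, Option.getD_some]

/-- `detL` of `groupMatrix` is the determinant of `minorZ` (square case). [folklore] -/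
theorem detL_groupMatrix (p : ℕ) (hk : g.cols.length = g.rows.length) :
    detL g.rows.length (groupMatrix tk vs g p) =
      ((minorZ tk vs g p).submatrix id (Fin.cast hk.symm)).det := by
  refine detL_eq_det _ _ _ (by simp [groupMatrix]) (fun r hr => ?_) (fun i j => ?_)
  · obtain ⟨x, _, rfl⟩ := List.mem_map.1 hr
    simp [hk]
  · rw [Matrix.submatrix_apply, ← groupMatrix_getD]
    rfl

variable {tk α β vs g}

/-- In the square case, entries of the minor over `K` are the evaluated kernel entries. [folklore] -/
theorem minorK_eq_eval (hc : colsOK vs g = true) (hr : rowsOK tk vs g = true) (t : Fin g.rows.length)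
    (r : Fin g.cols.length) :
    minorK tk α β vs g t r = (entry tk (vs.getD (g.cols.getD r (0, 0)).2 (.unit 0 0 0))
      (g.cols.getD r (0, 0)).1 (g.rows.getD t (0, 0, 0))).eval α β := by
  have hs : (g.cols.getD r (0, 0)).1 < 9 := by
    simp only [colsOK, List.all_eq_true] at hc
    have hmem : g.cols.getD r (0, 0) ∈ g.cols := by
      rw [List.getD_eq_getElem?_getD, List.getElem?_eq_getElem r.isLt]; exact List.getElem_mem _
    exact (by simpa using hc _ hmem : _ ∧ _).1
  have hx : (g.rows.getD t (0,0,0)).1 < 9 ∧ (g.rows.getD t (0,0,0)).2.1 < 9 ∧ (g.rows.getD t (0,0,0)).2.2 < 9 := by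
    simp only [rowsOK] at hr
    split at hr
    · simp at hr
    · simp only [List.all_eq_true] at hr
      have hmem : g.rows.getD t (0, 0, 0) ∈ g.rows := by
        rw [List.getD_eq_getElem?_getD, List.getElem?_eq_getElem t.isLt]; exact List.getElem_mem _
      have := hr _ hmem
      simp only [decide_eq_true_eq] at this
      exact ⟨this.1, this.2.1, this.2.2.1⟩
  exact colOf_decodeRow tk α β vs hs hx

/-- Constant entries evaluate to their integer part. [folklore] -/
theorem LF.eval_of_isConst (α β : K) {e : LF} (h : e.isConst = true) : e.eval α β = (e.1 : K) := by
  simp only [LF.isConst, Bool.and_eq_true, beq_iff_eq] at h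
  simp [LF.eval, h.1, h.2]

/-- Column `r` of the group is constant on the rows when `constCols` says so (`r` not the last
column in the parametric case). [folklore] -/
theorem entry_isConst_of_constCols (hcc : constCols tk vs g = true) (t : Fin g.rows.length)
    {r : ℕ} (hrlt : r < g.cols.length) (hr : g.par = true → r + 1 < g.cols.length) :
    (entry tk (vs.getD (g.cols.getD r (0, 0)).2 (.unit 0 0 0)) (g.cols.getD r (0, 0)).1
      (g.rows.getD t (0, 0, 0))).isConst = true := by
  simp only [constCols, List.all_eq_true] at hcc
  have hrow : g.rows.getD t (0, 0, 0) ∈ g.rows := by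
    rw [List.getD_eq_getElem?_getD, List.getElem?_eq_getElem t.isLt]; exact List.getElem_mem _
  refine hcc _ hrow _ ?_
  have hcol : g.cols.getD r (0, 0) = g.cols[r] := by
    rw [List.getD_eq_getElem?_getD, List.getElem?_eq_getElem hrlt]; rfl
  by_cases hp : g.par = true
  · rw [if_pos hp, hcol, List.dropLast_eq_take]
    exact List.mem_take_iff_getElem.2 ⟨r, by have := hr hp; simp; omega, rfl⟩
  · rw [if_neg hp, hcol]; exact List.getElem_mem _

/-- The determinant of an integer matrix cast to `K`. [folklore] -/
theorem det_map_intCast {n : Type} [Fintype n] [DecidableEq n] (M : Matrix n n ℤ) :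
    (M.map (Int.cast : ℤ → K)).det = ((M.det : ℤ) : K) := by
  have h := (RingHom.map_det (Int.castRingHom K) M).symm
  rw [RingHom.mapMatrix_apply, eq_intCast] at h
  have e : M.map (Int.cast : ℤ → K) = M.map ⇑(Int.castRingHom K) := by
    ext i j; simp
  rw [e]; exact h

/-- Unpacking an accepted group. [folklore] -/
theorem groupCond_spec {gen : Bool} (h : groupCond tk vs gen g = true) :
    g.cols.length = g.rows.length ∧ constCols tk vs g = true ∧
    ((g.par = false ∧ detL g.rows.length (groupMatrix tk vs g 0) ≠ 0) ∨
     (g.par = true ∧ gen = true ∧ detL g.rows.length (groupMatrix tk vs g 0) = 0 ∧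
       shapeOK (detL g.rows.length (groupMatrix tk vs g 1)) (detL g.rows.length (groupMatrix tk vs g 2)) = true)) := by
  simp only [groupCond, Bool.and_eq_true, beq_iff_eq] at h
  obtain ⟨⟨h1, h2⟩, h3⟩ := h
  refine ⟨h1, h2, ?_⟩
  by_cases hp : g.par = true
  · simp only [hp, if_true, Bool.and_eq_true, beq_iff_eq] at h3
    exact Or.inr ⟨hp, h3.1.1, h3.1.2, h3.2⟩
  · simp only [hp, Bool.false_eq_true, if_false, bne_iff_ne, ne_eq] at h3
    exact Or.inl ⟨by simpa using hp, h3⟩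

/-- **The determinant of an accepted group's minor is non-zero.** [cite: ConnerHarperLandsberg2023, §6] -/
theorem det_minorK_ne_zero [CharZero K] {gen : Bool} (hgen : gen = true → α ≠ 0 ∧ β ≠ 0 ∧ α ≠ β)
    (hc : colsOK vs g = true) (hrw : rowsOK tk vs g = true) (hcond : groupCond tk vs gen g = true)
    (hk : g.cols.length = g.rows.length) :
    ((minorK tk α β vs g).submatrix id (Fin.cast hk.symm)).det ≠ 0 := by
  obtain ⟨-, hcc, hcases⟩ := groupCond_spec hcond
  -- integer matrices and their determinants
  let Mz : ℕ → Matrix (Fin g.rows.length) (Fin g.rows.length) ℤ :=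
    fun p => (minorZ tk vs g p).submatrix id (Fin.cast hk.symm)
  have hdetL : ∀ p, detL g.rows.length (groupMatrix tk vs g p) = (Mz p).det :=
    fun p => detL_groupMatrix tk vs g p hk
  have hMz_apply : ∀ p (t r : Fin g.rows.length), Mz p t r =
      (let e := entry tk (vs.getD (g.cols.getD r (0, 0)).2 (.unit 0 0 0)) (g.cols.getD r (0, 0)).1
        (g.rows.getD t (0, 0, 0))
       if (r : ℕ) + 1 = g.cols.length then (if p = 0 then e.1 else if p = 1 then e.2.1 else e.2.2)
       else e.1) := by
    intro p t r; simp only [Mz, Matrix.submatrix_apply, minorZ, Fin.val_cast, id]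
  -- entries over `K`
  have hentry : ∀ (t r : Fin g.rows.length), (minorK tk α β vs g).submatrix id (Fin.cast hk.symm) t r =
      (entry tk (vs.getD (g.cols.getD r (0, 0)).2 (.unit 0 0 0)) (g.cols.getD r (0, 0)).1
        (g.rows.getD t (0, 0, 0))).eval α β := fun t r => by
    rw [Matrix.submatrix_apply]; exact minorK_eq_eval hc hrw t (Fin.cast hk.symm r)
  rcases hcases with ⟨hpar, hdz⟩ | ⟨hpar, hgen', hd0, hshape⟩
  · -- case A: the minor is an integer matrix
    have hMC : (minorK tk α β vs g).submatrix id (Fin.cast hk.symm) = (Mz 0).map (Int.cast : ℤ → K) := by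
      ext t r
      rw [hentry, Matrix.map_apply, hMz_apply]
      have hconst := entry_isConst_of_constCols hcc t (r := r) (by rw [hk]; exact r.isLt)
        (fun h => by rw [hpar] at h; exact absurd h Bool.false_ne_true)
      rw [LF.eval_of_isConst α β hconst]
      simp only [if_true]
      split_ifs <;> rfl
    rw [hMC, det_map_intCast]
    rw [hdetL] at hdz
    exact Int.cast_ne_zero.2 hdz
  · -- case B: linearity of `det` in the parametric last column
    obtain ⟨hα, hβ, hαβ⟩ := hgen hgen'
    have hpos : 0 < g.rows.length := by
      by_contra h0
      push Not at h0
      have : g.rows.length = 0 := by omega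
      -- `k = 0`: the `0 × 0` determinant is `1 ≠ 0`, contradicting `hd0`
      rw [hdetL] at hd0
      have : (Mz 0).det = 1 := by
        haveI : IsEmpty (Fin g.rows.length) := by rw [this]; infer_instance
        exact Matrix.det_isEmpty
      omega
    let last : Fin g.rows.length := ⟨g.rows.length - 1, by omega⟩
    have hlastval : ∀ r : Fin g.rows.length, ((r : ℕ) + 1 = g.cols.length) ↔ r = last := by
      intro r; constructor
      · intro h; exact Fin.ext (by simp [last]; omega)
      · intro h; rw [h]; simp [last]; omega
    let C : Matrix (Fin g.rows.length) (Fin g.rows.length) K := (Mz 0).map (Int.cast : ℤ → K)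
    let col : ℕ → Fin g.rows.length → K := fun p t => ((Mz p) t last : K)
    have hCp : ∀ p, (Mz p).map (Int.cast : ℤ → K) = C.updateCol last (col p) := by
      intro p
      ext t r
      rw [Matrix.updateCol_apply, Matrix.map_apply]
      by_cases hr : r = last
      · rw [if_pos hr, hr]
      · rw [if_neg hr]
        simp only [C, Matrix.map_apply, hMz_apply, (hlastval r).not.mpr hr, if_false]
    have hMcol : (minorK tk α β vs g).submatrix id (Fin.cast hk.symm) =
        C.updateCol last (col 0 + α • col 1 + β • col 2) := by
      ext t r
      rw [Matrix.updateCol_apply, hentry]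
      by_cases hr : r = last
      · rw [if_pos hr]
        simp only [Pi.add_apply, Pi.smul_apply, smul_eq_mul, col, hMz_apply, (hlastval last).2 rfl,
          if_true, hr]
        simp only [LF.eval, show (1 : ℕ) ≠ 0 from one_ne_zero, show (2 : ℕ) ≠ 0 from two_ne_zero,
          show (2 : ℕ) ≠ 1 from by decide, if_false]
        ring
      · rw [if_neg hr]
        have hr' : ¬ ((r : ℕ) + 1 = g.cols.length) := (hlastval r).not.mpr hr
        have hconst := entry_isConst_of_constCols hcc t (r := r) (by rw [hk]; exact r.isLt)
          (fun _ => by have := r.isLt; omega)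
        rw [LF.eval_of_isConst α β hconst]
        simp only [C, Matrix.map_apply, hMz_apply, hr', if_false]
    have hdet : ((minorK tk α β vs g).submatrix id (Fin.cast hk.symm)).det =
        ((Mz 0).det : K) + α * ((Mz 1).det : K) + β * ((Mz 2).det : K) := by
      rw [hMcol, Matrix.det_updateCol_add, Matrix.det_updateCol_add, Matrix.det_updateCol_smul,
        Matrix.det_updateCol_smul, ← hCp 0, ← hCp 1, ← hCp 2, det_map_intCast, det_map_intCast,
        det_map_intCast]
    rw [hdetL] at hd0
    rw [hdetL, hdetL] at hshape
    rw [hdet, hd0, Int.cast_zero, zero_add]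
    simp only [shapeOK, Bool.or_eq_true, Bool.and_eq_true, bne_iff_ne, ne_eq, beq_iff_eq] at hshape
    rcases hshape with (⟨h1, h2⟩ | ⟨h1, h2⟩) | ⟨h1, h2⟩
    · rw [h2, Int.cast_zero, mul_zero, add_zero]
      exact mul_ne_zero hα (Int.cast_ne_zero.2 h1)
    · rw [h1, Int.cast_zero, mul_zero, zero_add]
      exact mul_ne_zero hβ (Int.cast_ne_zero.2 h2)
    · have e : (α : K) * ((Mz 1).det : K) + β * ((Mz 2).det : K) = (α - β) * ((Mz 1).det : K) := by
        have : ((Mz 2).det : K) = -((Mz 1).det : K) := by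
          rw [← Int.cast_neg]; congr 1; omega
        rw [this]; ring
      rw [e]
      exact mul_ne_zero (sub_ne_zero.2 hαβ) (Int.cast_ne_zero.2 h1)

/-- **An accepted group consists of linearly independent columns.** [folklore] -/
theorem linearIndependent_of_groupCond [CharZero K] {gen : Bool} (hgen : gen = true → α ≠ 0 ∧ β ≠ 0 ∧ α ≠ β)
    (hc : colsOK vs g = true) (hrw : rowsOK tk vs g = true) (hcond : groupCond tk vs gen g = true) :
    LinearIndependent K fun r : Fin g.cols.length => colOf tk α β vs (g.cols.getD r (0, 0)) := by
  have hk : g.cols.length = g.rows.length := (groupCond_spec hcond).1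
  have hdet := det_minorK_ne_zero hgen hc hrw hcond hk
  rw [Fintype.linearIndependent_iff]
  intro c hc0 r
  set M := (minorK tk α β vs g).submatrix id (Fin.cast hk.symm) with hM
  have hmul : M.mulVec (fun r => c (Fin.cast hk.symm r)) = 0 := by
    funext t
    have h := congr_fun hc0 (decodeRow (g.rows.getD t (0, 0, 0)))
    simp only [Finset.sum_apply, Pi.smul_apply, smul_eq_mul, Pi.zero_apply] at h
    rw [Matrix.mulVec, dotProduct, Pi.zero_apply, ← h,
      ← Equiv.sum_comp (finCongr hk.symm) (fun r => c r * colOf tk α β vs (g.cols.getD r (0, 0)) _)]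
    refine Finset.sum_congr rfl fun r _ => ?_
    simp only [hM, Matrix.submatrix_apply, id, minorK, finCongr_apply]
    ring
  have hz := Matrix.eq_zero_of_mulVec_eq_zero hdet hmul
  have := congr_fun hz (Fin.cast hk r)
  simpa using this

end Group

end Ker

end MatMul3

end BorderApolarity

end Literature.Computability.AlgebraicComplexity

end
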